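import Summits.CriticalPhenomena.PercolationContinuityZ3.Theorems.PercNearOneGluingNoHeavyLowerTailForestRayleighKFourFull
import HarnessLib

/-!
# Weighted forest negative correlation — `K₄` III: the theorem for `K₄` and all its minors

Notation as in `…ForestRayleighTools`: `Z(D;K) = Σ_{G ⊆ D, ⟨G ∪ K⟩ acyclic} ∏ w`,
`(R)(D;K;e,f) : Z(D;K∪{e,f})·Z(D;K) ≤ Z(D;K∪e)·Z(D;K∪f)`.

**Theorem (`forestsW_rayleigh_K4`).** For four distinct vertices `a b c d : V` let
`T = {ab, ac, ad, bc, bd, cd}`. For all activities `w ≥ 0`, all disjoint `D, K` and `e ≠ f`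
outside `D ∪ K` with `D ∪ K ∪ {e,f} ⊆ T`: `Z(D;K∪{e,f})·Z(D;K) ≤ Z(D;K∪e)·Z(D;K∪f)` — the
weighted forest Rayleigh inequality (independence correlation of Semple–Welsh) for `K₄` and every
minor of it [Semple–Welsh, *Negative correlation in graphs and matroids*, CPC 17 (2008), §4: `M(K₄)`
is correlated (there via Maple on `AG(3,2)`); here: five explicit cells `…KFourCells` + symmetry +
the tree-width-2 theorem for `K₄ − edge`]. First on `Fin 4` (`forestsW_rayleigh_K4_fin`), then
transported to any `V` by `lsm_image`. With `…ForestRayleighTwoSum` and `…TreewidthTwo` this puts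
the whole Semple–Welsh class (2-sums of `K₄`'s and series–parallel graphs, their Thm. 4.4 with
2-sums in place of series–parallel extension) inside the kernel's reach.
Theorems only; no definitions, no `sorry`.
-/

open Finset SimpleGraph
open scoped Classical

namespace Summit.CriticalPhenomena.PercolationContinuityZ3.Theorems.ForestRayleigh

/-! ### §1 Symmetry transport of the full instances -/

/-- The edge set of `K₄` on `Fin 4` is the set of non-diagonal pairs. [elementary] -/
theorem mem_K4edges_iff : ∀ z : Sym2 (Fin 4), z ∈ ({s(0, 1), s(0, 2), s(0, 3), s(1, 2), s(1, 3), s(2, 3)} : Finset (Sym2 (Fin 4))) ↔ ¬z.IsDiag := by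
  decide

/-- A relabelled pair is diagonal iff the pair is (injective relabelling). [elementary] -/
theorem isDiag_map_iff {U V : Type*} (φ : U → V) (hφ : Function.Injective φ) (z : Sym2 U) :
    (Sym2.map φ z).IsDiag ↔ z.IsDiag := by
  induction z using Sym2.ind with
  | _ a b => rw [Sym2.map_mk, Sym2.mk_isDiag_iff, Sym2.mk_isDiag_iff]; exact hφ.eq_iff

/-- **Transport of the full instances by a symmetry of `K₄`.** If `(R)` holds for all full
instances with Rayleigh edges `(e₀, f₀)`, it holds for all full instances with Rayleigh edges
`(σ e₀, σ f₀)`, `σ ∈ S₄`. [elementary; `lsm_image`] -/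
theorem K4_full_transport (σ : Equiv.Perm (Fin 4)) (e₀ f₀ e f : Sym2 (Fin 4))
    (he : Sym2.map σ e₀ = e) (hf : Sym2.map σ f₀ = f)
    (hM : ∀ (w : Sym2 (Fin 4) → ℝ), (∀ x, 0 ≤ w x) → ∀ (D K : Finset (Sym2 (Fin 4))),
      D ∪ insert e₀ (insert f₀ K) ⊆ ({s(0, 1), s(0, 2), s(0, 3), s(1, 2), s(1, 3), s(2, 3)} : Finset (Sym2 (Fin 4))) →
      ({s(0, 1), s(0, 2), s(0, 3), s(1, 2), s(1, 3), s(2, 3)} : Finset (Sym2 (Fin 4))) ⊆ D ∪ insert e₀ (insert f₀ K) →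
      Disjoint D K → e₀ ∉ D → e₀ ∉ K → f₀ ∉ D → f₀ ∉ K →
      (∑ G ∈ D.powerset.filter (fun G =>
        (fromEdgeSet ((G ∪ (insert e₀ (insert f₀ (K))) : Finset (Sym2 (Fin 4))) : Set (Sym2 (Fin 4)))).IsAcyclic), ∏ x ∈ G, w x) *
        (∑ G ∈ D.powerset.filter (fun G =>
        (fromEdgeSet ((G ∪ (K) : Finset (Sym2 (Fin 4))) : Set (Sym2 (Fin 4)))).IsAcyclic), ∏ x ∈ G, w x) ≤
      (∑ G ∈ D.powerset.filter (fun G =>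
        (fromEdgeSet ((G ∪ (insert e₀ (K)) : Finset (Sym2 (Fin 4))) : Set (Sym2 (Fin 4)))).IsAcyclic), ∏ x ∈ G, w x) *
        (∑ G ∈ D.powerset.filter (fun G =>
        (fromEdgeSet ((G ∪ (insert f₀ (K)) : Finset (Sym2 (Fin 4))) : Set (Sym2 (Fin 4)))).IsAcyclic), ∏ x ∈ G, w x))
    (w : Sym2 (Fin 4) → ℝ) (hw : ∀ x, 0 ≤ w x) (D K : Finset (Sym2 (Fin 4)))
    (hsub : D ∪ insert e (insert f K) ⊆ ({s(0, 1), s(0, 2), s(0, 3), s(1, 2), s(1, 3), s(2, 3)} : Finset (Sym2 (Fin 4))))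
    (hfull : ({s(0, 1), s(0, 2), s(0, 3), s(1, 2), s(1, 3), s(2, 3)} : Finset (Sym2 (Fin 4))) ⊆ D ∪ insert e (insert f K))
    (hDK : Disjoint D K) (heD : e ∉ D) (heK : e ∉ K) (hfD : f ∉ D) (hfK : f ∉ K) :
    (∑ G ∈ D.powerset.filter (fun G =>
        (fromEdgeSet ((G ∪ (insert e (insert f (K))) : Finset (Sym2 (Fin 4))) : Set (Sym2 (Fin 4)))).IsAcyclic), ∏ x ∈ G, w x) *
      (∑ G ∈ D.powerset.filter (fun G =>
        (fromEdgeSet ((G ∪ (K) : Finset (Sym2 (Fin 4))) : Set (Sym2 (Fin 4)))).IsAcyclic), ∏ x ∈ G, w x) ≤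
    (∑ G ∈ D.powerset.filter (fun G =>
        (fromEdgeSet ((G ∪ (insert e (K)) : Finset (Sym2 (Fin 4))) : Set (Sym2 (Fin 4)))).IsAcyclic), ∏ x ∈ G, w x) *
      (∑ G ∈ D.powerset.filter (fun G =>
        (fromEdgeSet ((G ∪ (insert f (K)) : Finset (Sym2 (Fin 4))) : Set (Sym2 (Fin 4)))).IsAcyclic), ∏ x ∈ G, w x) := by
  subst he hf
  set τ : Equiv.Perm (Fin 4) := σ.symm with hτ
  have hinjS : Function.Injective (Sym2.map σ) := Sym2.map.injective σ.injective
  have hστ : ∀ z : Sym2 (Fin 4), Sym2.map σ (Sym2.map τ z) = z := fun z => by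
    rw [Sym2.map_map, hτ, Equiv.self_comp_symm]; exact congrFun Sym2.map_id z
  have hτσ : ∀ z : Sym2 (Fin 4), Sym2.map τ (Sym2.map σ z) = z := fun z => by
    rw [Sym2.map_map, hτ, Equiv.symm_comp_self]; exact congrFun Sym2.map_id z
  have himg : ∀ X : Finset (Sym2 (Fin 4)), (X.image (Sym2.map τ)).image (Sym2.map σ) = X := by
    intro X
    rw [Finset.image_image]
    conv_rhs => rw [← Finset.image_id (s := X)]
    exact Finset.image_congr fun z _ => hστ z
  have hT : ∀ z : Sym2 (Fin 4), z ∈ ({s(0, 1), s(0, 2), s(0, 3), s(1, 2), s(1, 3), s(2, 3)} : Finset (Sym2 (Fin 4))) →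
      Sym2.map τ z ∈ ({s(0, 1), s(0, 2), s(0, 3), s(1, 2), s(1, 3), s(2, 3)} : Finset (Sym2 (Fin 4))) := by
    intro z hz
    rw [mem_K4edges_iff] at hz ⊢
    rwa [isDiag_map_iff _ τ.injective]
  set D₀ := D.image (Sym2.map τ) with hD₀
  set K₀ := K.image (Sym2.map τ) with hK₀
  have hmemD : ∀ z, z ∈ D₀ ↔ Sym2.map σ z ∈ D := by
    intro z; rw [hD₀, Finset.mem_image]; constructor
    · rintro ⟨y, hy, rfl⟩; rw [hστ]; exact hy
    · intro h; exact ⟨_, h, hτσ z⟩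
  have hmemK : ∀ z, z ∈ K₀ ↔ Sym2.map σ z ∈ K := by
    intro z; rw [hK₀, Finset.mem_image]; constructor
    · rintro ⟨y, hy, rfl⟩; rw [hστ]; exact hy
    · intro h; exact ⟨_, h, hτσ z⟩
  have h₀ := hM (fun x => w (Sym2.map σ x)) (fun x => hw _) D₀ K₀ ?_ ?_ ?_ ?_ ?_ ?_ ?_
  · have h₁ := lsm_image (⇑σ) σ.injective w D₀ K₀ e₀ f₀ (fun z hz => by
      rw [← mem_K4edges_iff]
      rcases Finset.mem_union.1 hz with h | h
      · have := hsub (Finset.mem_union_left _ ((hmemD z).1 h)); rw [← hτσ z]; exact hT _ this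
      · rcases Finset.mem_insert.1 h with rfl | h
        · rw [← hτσ z]; exact hT _ (hsub (by simp))
        · rcases Finset.mem_insert.1 h with rfl | h
          · rw [← hτσ z]; exact hT _ (hsub (by simp))
          · have := hsub (Finset.mem_union_right _ (Finset.mem_insert_of_mem
              (Finset.mem_insert_of_mem ((hmemK z).1 h)))); rw [← hτσ z]; exact hT _ this) h₀
    rw [himg D, himg K] at h₁
    exact h₁
  · -- `D₀ ∪ {e₀,f₀} ∪ K₀ ⊆ T₀`
    intro z hz
    rw [← hτσ z]
    apply hT
    rcases Finset.mem_union.1 hz with h | h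
    · exact hsub (Finset.mem_union_left _ ((hmemD z).1 h))
    · rcases Finset.mem_insert.1 h with rfl | h
      · exact hsub (by simp)
      · rcases Finset.mem_insert.1 h with rfl | h
        · exact hsub (by simp)
        · exact hsub (Finset.mem_union_right _ (Finset.mem_insert_of_mem
            (Finset.mem_insert_of_mem ((hmemK z).1 h))))
  · -- fullness
    intro z hz
    have hzT : Sym2.map σ z ∈ ({s(0, 1), s(0, 2), s(0, 3), s(1, 2), s(1, 3), s(2, 3)} : Finset (Sym2 (Fin 4))) :=
      (mem_K4edges_iff _).2 ((isDiag_map_iff _ σ.injective _).not.2 ((mem_K4edges_iff _).1 hz))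
    have hz' := hfull hzT
    rcases Finset.mem_union.1 hz' with h | h
    · exact Finset.mem_union_left _ ((hmemD z).2 h)
    · rcases Finset.mem_insert.1 h with h | h
      · rw [hinjS h]; simp
      · rcases Finset.mem_insert.1 h with h | h
        · rw [hinjS h]; simp
        · exact Finset.mem_union_right _ (Finset.mem_insert_of_mem (Finset.mem_insert_of_mem
            ((hmemK z).2 h)))
  · exact Finset.disjoint_left.2 fun z h₁ h₂ =>
      Finset.disjoint_left.1 hDK ((hmemD z).1 h₁) ((hmemK z).1 h₂)
  · exact fun h => heD ((hmemD _).1 h)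
  · exact fun h => heK ((hmemK _).1 h)
  · exact fun h => hfD ((hmemD _).1 h)
  · exact fun h => hfK ((hmemK _).1 h)

/-! ### §2 `K₄` on `Fin 4` -/

set_option maxHeartbeats 400000 in
/-- **`(R)` for every instance inside `K₄` on `Fin 4`.** [Semple–Welsh 2008 §4] -/
theorem forestsW_rayleigh_K4_fin (w : Sym2 (Fin 4) → ℝ) (hw : ∀ x, 0 ≤ w x)
    (D K : Finset (Sym2 (Fin 4))) (e f : Sym2 (Fin 4))
    (hsub : D ∪ insert e (insert f K) ⊆ ({s(0, 1), s(0, 2), s(0, 3), s(1, 2), s(1, 3), s(2, 3)} : Finset (Sym2 (Fin 4))))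
    (hDK : Disjoint D K) (heD : e ∉ D) (heK : e ∉ K) (hfD : f ∉ D) (hfK : f ∉ K) (hef : e ≠ f) :
    (∑ G ∈ D.powerset.filter (fun G =>
        (fromEdgeSet ((G ∪ (insert e (insert f (K))) : Finset (Sym2 (Fin 4))) : Set (Sym2 (Fin 4)))).IsAcyclic), ∏ x ∈ G, w x) *
      (∑ G ∈ D.powerset.filter (fun G =>
        (fromEdgeSet ((G ∪ (K) : Finset (Sym2 (Fin 4))) : Set (Sym2 (Fin 4)))).IsAcyclic), ∏ x ∈ G, w x) ≤
    (∑ G ∈ D.powerset.filter (fun G =>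
        (fromEdgeSet ((G ∪ (insert e (K)) : Finset (Sym2 (Fin 4))) : Set (Sym2 (Fin 4)))).IsAcyclic), ∏ x ∈ G, w x) *
      (∑ G ∈ D.powerset.filter (fun G =>
        (fromEdgeSet ((G ∪ (insert f (K)) : Finset (Sym2 (Fin 4))) : Set (Sym2 (Fin 4)))).IsAcyclic), ∏ x ∈ G, w x) := by
  by_cases hfull : ({s(0, 1), s(0, 2), s(0, 3), s(1, 2), s(1, 3), s(2, 3)} : Finset (Sym2 (Fin 4))) ⊆ D ∪ insert e (insert f K)
  · -- all six edges are used: `e`, `f` are two of them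
    have he : e ∈ ({s(0, 1), s(0, 2), s(0, 3), s(1, 2), s(1, 3), s(2, 3)} : Finset (Sym2 (Fin 4))) := hsub (by simp)
    have hf : f ∈ ({s(0, 1), s(0, 2), s(0, 3), s(1, 2), s(1, 3), s(2, 3)} : Finset (Sym2 (Fin 4))) := hsub (by simp)
    simp only [Finset.mem_insert, Finset.mem_singleton] at he hf
    rcases he with rfl | rfl | rfl | rfl | rfl | rfl <;> rcases hf with rfl | rfl | rfl | rfl | rfl | rfl
    · exact absurd rfl hef
    · exact K4_full_transport (Equiv.refl (Fin 4)) s(0, 1) s(0, 2) _ _ (by decide) (by decide)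
        K4_full_01_02 w hw D K hsub hfull hDK heD heK hfD hfK
    · exact K4_full_transport (Equiv.swap (2 : Fin 4) 3) s(0, 1) s(0, 2) _ _ (by decide) (by decide)
        K4_full_01_02 w hw D K hsub hfull hDK heD heK hfD hfK
    · exact K4_full_transport (Equiv.swap (0 : Fin 4) 1) s(0, 1) s(0, 2) _ _ (by decide) (by decide)
        K4_full_01_02 w hw D K hsub hfull hDK heD heK hfD hfK
    · exact K4_full_transport (Equiv.swap (2 : Fin 4) 3 * Equiv.swap (0 : Fin 4) 1) s(0, 1) s(0, 2) _ _ (by decide) (by decide)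
        K4_full_01_02 w hw D K hsub hfull hDK heD heK hfD hfK
    · exact K4_full_transport (Equiv.refl (Fin 4)) s(0, 1) s(2, 3) _ _ (by decide) (by decide)
        K4_full_01_23 w hw D K hsub hfull hDK heD heK hfD hfK
    · exact K4_full_transport (Equiv.swap (1 : Fin 4) 2) s(0, 1) s(0, 2) _ _ (by decide) (by decide)
        K4_full_01_02 w hw D K hsub hfull hDK heD heK hfD hfK
    · exact absurd rfl hef
    · exact K4_full_transport (Equiv.swap (1 : Fin 4) 3 * Equiv.swap (1 : Fin 4) 2) s(0, 1) s(0, 2) _ _ (by decide) (by decide)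
        K4_full_01_02 w hw D K hsub hfull hDK heD heK hfD hfK
    · exact K4_full_transport (Equiv.swap (1 : Fin 4) 2 * Equiv.swap (0 : Fin 4) 1) s(0, 1) s(0, 2) _ _ (by decide) (by decide)
        K4_full_01_02 w hw D K hsub hfull hDK heD heK hfD hfK
    · exact K4_full_transport (Equiv.swap (1 : Fin 4) 2) s(0, 1) s(2, 3) _ _ (by decide) (by decide)
        K4_full_01_23 w hw D K hsub hfull hDK heD heK hfD hfK
    · exact K4_full_transport (Equiv.swap (1 : Fin 4) 3 * Equiv.swap (1 : Fin 4) 2 * Equiv.swap (0 : Fin 4) 1) s(0, 1) s(0, 2) _ _ (by decide) (by decide)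
        K4_full_01_02 w hw D K hsub hfull hDK heD heK hfD hfK
    · exact K4_full_transport (Equiv.swap (2 : Fin 4) 3 * Equiv.swap (1 : Fin 4) 2) s(0, 1) s(0, 2) _ _ (by decide) (by decide)
        K4_full_01_02 w hw D K hsub hfull hDK heD heK hfD hfK
    · exact K4_full_transport (Equiv.swap (1 : Fin 4) 3) s(0, 1) s(0, 2) _ _ (by decide) (by decide)
        K4_full_01_02 w hw D K hsub hfull hDK heD heK hfD hfK
    · exact absurd rfl hef
    · exact K4_full_transport (Equiv.swap (2 : Fin 4) 3 * Equiv.swap (1 : Fin 4) 2) s(0, 1) s(2, 3) _ _ (by decide) (by decide)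
        K4_full_01_23 w hw D K hsub hfull hDK heD heK hfD hfK
    · exact K4_full_transport (Equiv.swap (2 : Fin 4) 3 * Equiv.swap (1 : Fin 4) 2 * Equiv.swap (0 : Fin 4) 1) s(0, 1) s(0, 2) _ _ (by decide) (by decide)
        K4_full_01_02 w hw D K hsub hfull hDK heD heK hfD hfK
    · exact K4_full_transport (Equiv.swap (1 : Fin 4) 3 * Equiv.swap (0 : Fin 4) 1) s(0, 1) s(0, 2) _ _ (by decide) (by decide)
        K4_full_01_02 w hw D K hsub hfull hDK heD heK hfD hfK
    · exact K4_full_transport (Equiv.swap (0 : Fin 4) 2 * Equiv.swap (0 : Fin 4) 1) s(0, 1) s(0, 2) _ _ (by decide) (by decide)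
        K4_full_01_02 w hw D K hsub hfull hDK heD heK hfD hfK
    · exact K4_full_transport (Equiv.swap (0 : Fin 4) 2) s(0, 1) s(0, 2) _ _ (by decide) (by decide)
        K4_full_01_02 w hw D K hsub hfull hDK heD heK hfD hfK
    · exact K4_full_transport (Equiv.swap (0 : Fin 4) 2 * Equiv.swap (0 : Fin 4) 1) s(0, 1) s(2, 3) _ _ (by decide) (by decide)
        K4_full_01_23 w hw D K hsub hfull hDK heD heK hfD hfK
    · exact absurd rfl hef
    · exact K4_full_transport (Equiv.swap (0 : Fin 4) 3 * Equiv.swap (0 : Fin 4) 2 * Equiv.swap (0 : Fin 4) 1) s(0, 1) s(0, 2) _ _ (by decide) (by decide)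
        K4_full_01_02 w hw D K hsub hfull hDK heD heK hfD hfK
    · exact K4_full_transport (Equiv.swap (0 : Fin 4) 3 * Equiv.swap (0 : Fin 4) 2) s(0, 1) s(0, 2) _ _ (by decide) (by decide)
        K4_full_01_02 w hw D K hsub hfull hDK heD heK hfD hfK
    · exact K4_full_transport (Equiv.swap (2 : Fin 4) 3 * Equiv.swap (0 : Fin 4) 2 * Equiv.swap (0 : Fin 4) 1) s(0, 1) s(0, 2) _ _ (by decide) (by decide)
        K4_full_01_02 w hw D K hsub hfull hDK heD heK hfD hfK
    · exact K4_full_transport (Equiv.swap (2 : Fin 4) 3 * Equiv.swap (0 : Fin 4) 2 * Equiv.swap (0 : Fin 4) 1) s(0, 1) s(2, 3) _ _ (by decide) (by decide)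
        K4_full_01_23 w hw D K hsub hfull hDK heD heK hfD hfK
    · exact K4_full_transport (Equiv.swap (2 : Fin 4) 3 * Equiv.swap (0 : Fin 4) 2) s(0, 1) s(0, 2) _ _ (by decide) (by decide)
        K4_full_01_02 w hw D K hsub hfull hDK heD heK hfD hfK
    · exact K4_full_transport (Equiv.swap (0 : Fin 4) 3 * Equiv.swap (0 : Fin 4) 1) s(0, 1) s(0, 2) _ _ (by decide) (by decide)
        K4_full_01_02 w hw D K hsub hfull hDK heD heK hfD hfK
    · exact absurd rfl hef
    · exact K4_full_transport (Equiv.swap (0 : Fin 4) 3) s(0, 1) s(0, 2) _ _ (by decide) (by decide)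
        K4_full_01_02 w hw D K hsub hfull hDK heD heK hfD hfK
    · exact K4_full_transport (Equiv.swap (1 : Fin 4) 3 * Equiv.swap (0 : Fin 4) 2) s(0, 1) s(2, 3) _ _ (by decide) (by decide)
        K4_full_01_23 w hw D K hsub hfull hDK heD heK hfD hfK
    · exact K4_full_transport (Equiv.swap (1 : Fin 4) 3 * Equiv.swap (0 : Fin 4) 2) s(0, 1) s(0, 2) _ _ (by decide) (by decide)
        K4_full_01_02 w hw D K hsub hfull hDK heD heK hfD hfK
    · exact K4_full_transport (Equiv.swap (1 : Fin 4) 3 * Equiv.swap (0 : Fin 4) 2 * Equiv.swap (0 : Fin 4) 1) s(0, 1) s(0, 2) _ _ (by decide) (by decide)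
        K4_full_01_02 w hw D K hsub hfull hDK heD heK hfD hfK
    · exact K4_full_transport (Equiv.swap (1 : Fin 4) 2 * Equiv.swap (0 : Fin 4) 3 * Equiv.swap (0 : Fin 4) 1) s(0, 1) s(0, 2) _ _ (by decide) (by decide)
        K4_full_01_02 w hw D K hsub hfull hDK heD heK hfD hfK
    · exact K4_full_transport (Equiv.swap (1 : Fin 4) 2 * Equiv.swap (0 : Fin 4) 3) s(0, 1) s(0, 2) _ _ (by decide) (by decide)
        K4_full_01_02 w hw D K hsub hfull hDK heD heK hfD hfK
    · exact absurd rfl hef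
  · -- some edge `g` of `K₄` is unused: the instance lives in `K₄ − g`, of tree-width 2
    obtain ⟨g, hg, hgn⟩ := Finset.not_subset.1 hfull
    have key : ∀ g z : Sym2 (Fin 4), g ∈ ({s(0, 1), s(0, 2), s(0, 3), s(1, 2), s(1, 3), s(2, 3)} : Finset (Sym2 (Fin 4))) →
        z ∈ ({s(0, 1), s(0, 2), s(0, 3), s(1, 2), s(1, 3), s(2, 3)} : Finset (Sym2 (Fin 4))) → z ≠ g →
        z ∈ (({s(0, 1), s(0, 2), s(0, 3), s(1, 2), s(1, 3), s(2, 3)} : Finset (Sym2 (Fin 4)))).erase g := by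
      intro g z hg hz hne; exact Finset.mem_erase.2 ⟨hne, hz⟩
    have hsub' : D ∪ insert e (insert f K) ⊆
        (({s(0, 1), s(0, 2), s(0, 3), s(1, 2), s(1, 3), s(2, 3)} : Finset (Sym2 (Fin 4)))).erase g :=
      fun z hz => key g z hg (hsub hz) (fun h => hgn (h ▸ hz))
    simp only [Finset.mem_insert, Finset.mem_singleton] at hg
    rcases hg with rfl | rfl | rfl | rfl | rfl | rfl
    · rw [show (({s(0, 1), s(0, 2), s(0, 3), s(1, 2), s(1, 3), s(2, 3)} : Finset (Sym2 (Fin 4)))).erase s(0, 1) =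
          ({s(0, 2), s(0, 3), s(1, 2), s(1, 3), s(2, 3)} : Finset (Sym2 (Fin 4))) from by decide] at hsub'
      exact forestsW_rayleigh_of_elimOrder ({s(0, 2), s(0, 3), s(1, 2), s(1, 3), s(2, 3)} : Finset (Sym2 (Fin 4)))
        ![0, 0, 1, 2] (by decide) (by decide) (by decide) w hw D K e f hsub' hDK heD heK hfD hfK hef
    · rw [show (({s(0, 1), s(0, 2), s(0, 3), s(1, 2), s(1, 3), s(2, 3)} : Finset (Sym2 (Fin 4)))).erase s(0, 2) =
          ({s(0, 1), s(0, 3), s(1, 2), s(1, 3), s(2, 3)} : Finset (Sym2 (Fin 4))) from by decide] at hsub'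
      exact forestsW_rayleigh_of_elimOrder ({s(0, 1), s(0, 3), s(1, 2), s(1, 3), s(2, 3)} : Finset (Sym2 (Fin 4)))
        ![0, 1, 0, 2] (by decide) (by decide) (by decide) w hw D K e f hsub' hDK heD heK hfD hfK hef
    · rw [show (({s(0, 1), s(0, 2), s(0, 3), s(1, 2), s(1, 3), s(2, 3)} : Finset (Sym2 (Fin 4)))).erase s(0, 3) =
          ({s(0, 1), s(0, 2), s(1, 2), s(1, 3), s(2, 3)} : Finset (Sym2 (Fin 4))) from by decide] at hsub'
      exact forestsW_rayleigh_of_elimOrder ({s(0, 1), s(0, 2), s(1, 2), s(1, 3), s(2, 3)} : Finset (Sym2 (Fin 4)))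
        ![0, 1, 2, 0] (by decide) (by decide) (by decide) w hw D K e f hsub' hDK heD heK hfD hfK hef
    · rw [show (({s(0, 1), s(0, 2), s(0, 3), s(1, 2), s(1, 3), s(2, 3)} : Finset (Sym2 (Fin 4)))).erase s(1, 2) =
          ({s(0, 1), s(0, 2), s(0, 3), s(1, 3), s(2, 3)} : Finset (Sym2 (Fin 4))) from by decide] at hsub'
      exact forestsW_rayleigh_of_elimOrder ({s(0, 1), s(0, 2), s(0, 3), s(1, 3), s(2, 3)} : Finset (Sym2 (Fin 4)))
        ![1, 0, 0, 2] (by decide) (by decide) (by decide) w hw D K e f hsub' hDK heD heK hfD hfK hef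
    · rw [show (({s(0, 1), s(0, 2), s(0, 3), s(1, 2), s(1, 3), s(2, 3)} : Finset (Sym2 (Fin 4)))).erase s(1, 3) =
          ({s(0, 1), s(0, 2), s(0, 3), s(1, 2), s(2, 3)} : Finset (Sym2 (Fin 4))) from by decide] at hsub'
      exact forestsW_rayleigh_of_elimOrder ({s(0, 1), s(0, 2), s(0, 3), s(1, 2), s(2, 3)} : Finset (Sym2 (Fin 4)))
        ![1, 0, 2, 0] (by decide) (by decide) (by decide) w hw D K e f hsub' hDK heD heK hfD hfK hef
    · rw [show (({s(0, 1), s(0, 2), s(0, 3), s(1, 2), s(1, 3), s(2, 3)} : Finset (Sym2 (Fin 4)))).erase s(2, 3) =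
          ({s(0, 1), s(0, 2), s(0, 3), s(1, 2), s(1, 3)} : Finset (Sym2 (Fin 4))) from by decide] at hsub'
      exact forestsW_rayleigh_of_elimOrder ({s(0, 1), s(0, 2), s(0, 3), s(1, 2), s(1, 3)} : Finset (Sym2 (Fin 4)))
        ![1, 2, 0, 0] (by decide) (by decide) (by decide) w hw D K e f hsub' hDK heD heK hfD hfK hef

/-! ### §3 `K₄` on four distinct vertices of any type -/

section AnyV

variable {V : Type*} [Fintype V] [DecidableEq V]

/-- **Weighted forest Rayleigh inequality for `K₄` and all its minors** (independence
correlation of `M(K₄)`, Semple–Welsh 2008 §4), on four distinct vertices `a b c d` of any `V`: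
for `T = {ab,ac,ad,bc,bd,cd}`, all `w ≥ 0`, disjoint `D, K`, `e ≠ f ∉ D ∪ K`, `D ∪ K ∪ {e,f} ⊆ T`:
`Z(D;K∪{e,f})·Z(D;K) ≤ Z(D;K∪e)·Z(D;K∪f)`. [S–W 2008 §4; kernel proof via `Fin 4`] -/
theorem forestsW_rayleigh_K4 (a b c d : V) (hab : a ≠ b) (hac : a ≠ c) (had : a ≠ d) (hbc : b ≠ c)
    (hbd : b ≠ d) (hcd : c ≠ d) (w : Sym2 V → ℝ) (hw : ∀ x, 0 ≤ w x) (D K : Finset (Sym2 V))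
    (e f : Sym2 V)
    (hsub : D ∪ insert e (insert f K) ⊆ ({s(a, b), s(a, c), s(a, d), s(b, c), s(b, d), s(c, d)} : Finset (Sym2 V)))
    (hDK : Disjoint D K) (heD : e ∉ D) (heK : e ∉ K) (hfD : f ∉ D) (hfK : f ∉ K) (hef : e ≠ f) :
    (∑ G ∈ D.powerset.filter (fun G =>
        (fromEdgeSet ((G ∪ (insert e (insert f (K))) : Finset (Sym2 (V))) : Set (Sym2 (V)))).IsAcyclic), ∏ x ∈ G, w x) *
      (∑ G ∈ D.powerset.filter (fun G =>
        (fromEdgeSet ((G ∪ (K) : Finset (Sym2 (V))) : Set (Sym2 (V)))).IsAcyclic), ∏ x ∈ G, w x) ≤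
    (∑ G ∈ D.powerset.filter (fun G =>
        (fromEdgeSet ((G ∪ (insert e (K)) : Finset (Sym2 (V))) : Set (Sym2 (V)))).IsAcyclic), ∏ x ∈ G, w x) *
      (∑ G ∈ D.powerset.filter (fun G =>
        (fromEdgeSet ((G ∪ (insert f (K)) : Finset (Sym2 (V))) : Set (Sym2 (V)))).IsAcyclic), ∏ x ∈ G, w x) := by
  -- the labelling `φ = ![a,b,c,d]`
  set φ : Fin 4 → V := ![a, b, c, d] with hφ
  have h0 : φ 0 = a := rfl
  have h1 : φ 1 = b := rfl
  have h2 : φ 2 = c := rfl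
  have h3 : φ 3 = d := rfl
  have hφi : Function.Injective φ := by
    intro i j h
    fin_cases i <;> fin_cases j <;> simp_all
  have hT : ({s(a, b), s(a, c), s(a, d), s(b, c), s(b, d), s(c, d)} : Finset (Sym2 V)) =
      (({s(0, 1), s(0, 2), s(0, 3), s(1, 2), s(1, 3), s(2, 3)} : Finset (Sym2 (Fin 4)))).image (Sym2.map φ) := by
    simp only [Finset.image_insert, Finset.image_singleton, Sym2.map_mk, h0, h1, h2, h3]
  rw [hT] at hsub
  -- pull the instance back to `Fin 4`
  have hDsub : D ⊆ (({s(0, 1), s(0, 2), s(0, 3), s(1, 2), s(1, 3), s(2, 3)} : Finset (Sym2 (Fin 4)))).image (Sym2.map φ) := fun z hz => hsub (Finset.mem_union_left _ hz)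
  have hKsub : K ⊆ (({s(0, 1), s(0, 2), s(0, 3), s(1, 2), s(1, 3), s(2, 3)} : Finset (Sym2 (Fin 4)))).image (Sym2.map φ) := fun z hz =>
    hsub (Finset.mem_union_right _ (Finset.mem_insert_of_mem (Finset.mem_insert_of_mem hz)))
  have heT : e ∈ (({s(0, 1), s(0, 2), s(0, 3), s(1, 2), s(1, 3), s(2, 3)} : Finset (Sym2 (Fin 4)))).image (Sym2.map φ) :=
    hsub (Finset.mem_union_right _ (Finset.mem_insert_self _ _))
  have hfT : f ∈ (({s(0, 1), s(0, 2), s(0, 3), s(1, 2), s(1, 3), s(2, 3)} : Finset (Sym2 (Fin 4)))).image (Sym2.map φ) :=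
    hsub (Finset.mem_union_right _ (Finset.mem_insert_of_mem (Finset.mem_insert_self _ _)))
  obtain ⟨D₀, hD₀, rfl⟩ := Finset.subset_image_iff.1 hDsub
  obtain ⟨K₀, hK₀, rfl⟩ := Finset.subset_image_iff.1 hKsub
  obtain ⟨e₀, he₀, rfl⟩ := Finset.mem_image.1 heT
  obtain ⟨f₀, hf₀, rfl⟩ := Finset.mem_image.1 hfT
  have hΦ : Function.Injective (Sym2.map φ) := Sym2.map.injective hφi
  have heD₀ : e₀ ∉ D₀ := fun h => heD (Finset.mem_image_of_mem _ h)
  have heK₀ : e₀ ∉ K₀ := fun h => heK (Finset.mem_image_of_mem _ h)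
  have hfD₀ : f₀ ∉ D₀ := fun h => hfD (Finset.mem_image_of_mem _ h)
  have hfK₀ : f₀ ∉ K₀ := fun h => hfK (Finset.mem_image_of_mem _ h)
  have hef₀ : e₀ ≠ f₀ := fun h => hef (h ▸ rfl)
  have hDK₀ : Disjoint D₀ K₀ := Finset.disjoint_left.2 fun z h₁ h₂ =>
    Finset.disjoint_left.1 hDK (Finset.mem_image_of_mem _ h₁) (Finset.mem_image_of_mem _ h₂)
  have hsub₀ : D₀ ∪ insert e₀ (insert f₀ K₀) ⊆ ({s(0, 1), s(0, 2), s(0, 3), s(1, 2), s(1, 3), s(2, 3)} : Finset (Sym2 (Fin 4))) :=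
    Finset.union_subset hD₀ (Finset.insert_subset he₀ (Finset.insert_subset hf₀ hK₀))
  refine lsm_image φ hφi w D₀ K₀ e₀ f₀ (fun z hz => (mem_K4edges_iff z).1 (hsub₀ hz)) ?_
  exact forestsW_rayleigh_K4_fin (fun x => w (Sym2.map φ x)) (fun x => hw _) D₀ K₀ e₀ f₀ hsub₀ hDK₀
    heD₀ heK₀ hfD₀ hfK₀ hef₀

end AnyV

end Summit.CriticalPhenomena.PercolationContinuityZ3.Theorems.ForestRayleigh
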